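import Literature.NumberTheory.EllipticCurves.ZpExtensionEisensteinTowerReadoutBijectiveProofs
import Literature.NumberTheory.EllipticCurves.ZpExtensionEisensteinOrdinaryFiltration
import Literature.NumberTheory.EllipticCurves.ZpExtensionEisensteinSelmerStructure
import Literature.NumberTheory.EllipticCurves.IwasawaEisensteinTwistedReadoutReduceProofs
import Literature.NumberTheory.EllipticCurves.Greenberg1999.KummerImageGoodOrdinaryNumberField
import HarnessLib

/-!
# Reading out Howard's strict ordinary cores at `v ∣ p` modulo `C_v = E[p^∞] ∩ E₁(K̄_v)`, and the descent of the
# saturation exponent down the local tower (proofs file, part 1 of the `v ∣ p` clause)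

Topic `NumberTheory/EllipticCurves` (cell `pub/bsd-print-x9`, blueprint HOME/p2/S1-DISCRETE-CONTROL §2 «v ∣ p» = file F7;
sequel to `ZpExtensionEisensteinTowerReadoutBijectiveProofs` (the readout `H¹(K, A_𝔮) → H¹(K_∞, E[p^∞])`),
`ZpExtensionEisensteinSelmerStructure` / `…OrdinaryFiltration` (Howard's `F_𝔮` at `v ∣ p`: the level condition of the
saturated tower of strict ordinary cores, `Fil_v E[p^k] = E[p^k] ∩ E₁(K̄_v)`) and
`Greenberg1999/KummerImageGoodOrdinaryNumberField` (the cite-only leaf (CG) = Greenberg LNM 1716 Prop. 2.4 and its F7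
projection `kerSubgroup_strictKer_le_localKerOver`)). THEOREMS ONLY; no definition, no named fact, no instance, no `sorry`.

For `E = W_K`, a `ℤ_p`-extension `κ`, `m ≥ 1`, the tower `T^{(k)} = E[p^{k+1}] ⊗ A_{m,k+1}(ψ⁻¹)` and a place `v ∣ p`:

* §1 module lemmas: the tail readout of the twisted plus part `A ⊗ Fil_v` lies in `Fil_v`
  (`tailReadout_mem_torsionFilAt_of_mem_twistedFil`); along the reduction `T^{(j+1)} → T^{(j)}` the readouts satisfy
  `ι(λ_j (red y)) = p · ι(λ_{j+1} y)` in `E[p^∞]` (`inclusion_tailReadout_eisensteinTwistReduce`).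
* §2 `exists_sub_mem_plus_of_mem_ordinaryCore` (and `exists_cocycle_…`) — a local class in the strict ordinary CORE has a
  cocycle whose readout is, on `Gal(K̄_v/K_{∞,w})`, a coboundary modulo `C_v = E[p^∞] ∩ E₁(K̄_v)`.
* §3 `exists_cocycle_sub_mem_plus_eisensteinLocalReduce`, `exists_cocycle_sub_mem_plus_of_compatible` — the same down a
  compatible family of the local tower (the LEVEL CONDITION = saturated tower): descend the saturation exponent using
  `ι ∘ λ_j ∘ red = p · ι ∘ λ_{j+1}`.
* Part 2 (`ZpExtensionEisensteinReadoutOrdinaryStrictProofs`) assembles these into: the readout of Howard's ordinary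
  condition lies in Greenberg's strict condition over `K_∞`, hence ((CG), Greenberg Prop. 2.4) in the local condition of
  `Sel_{p^∞}(E/K_∞)` at the place above `v` (binder (B4) at `v ∣ p` of the discrete half of the shared μ-crux's
  `stub_controlGlue`).

References: [Howard2004HeegnerKolyvagin] §3.1 (H¹_ord), Def. 3.2.5, Lemma 2.2.7 / Prop. 2.2.8, proof of Thm. 2.2.10;
[GreenbergLNM1716] §2 Prop. 2.2, Prop. 2.4 (pp. 73–80); [Greenberg1989] §1 p. 98 (strict condition).
BSD is not proved by any of this.
-/

noncomputable section

open scoped Classical ContRepresentation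

open NumberField IsDedekindDomain Field
open Literature.NumberTheory.EllipticCurves Literature.NumberTheory.GaloisRepresentations
open Literature.NumberTheory.GaloisRepresentations.galoisCohomology
open Literature.NumberTheory.GaloisCohomology.Howard2004
open Literature.NumberTheory.EllipticCurves.GreenbergSelmer
open IwasawaAlgebra IwasawaAlgebra.EisensteinCoeff

namespace WeierstrassCurve

variable {K : Type} [Field K] [NumberField K] (V : WeierstrassCurve K) {p : ℕ} [hp : Fact p.Prime]
  (κ : ZpExtension K p) {m : ℕ} (hm : 1 ≤ m) (v : HeightOneSpectrum (𝓞 K))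

/-! ## §1 Module lemmas: readouts of the plus part, readouts along the reduction -/

/-- **The tail readout of the twisted plus part lies in the plus part**: `λ_j(A_{m,j} ⊗ Fil_v E[p^j]) ⊆ Fil_v E[p^j]`
(`λ_j(c ⊗ a) = λ_j(c) • a`). [cite: Howard2004HeegnerKolyvagin, §3.1 (arXiv p. 15, L56–62: Fil_v T_𝔮 = (Fil_v T) ⊗ S_𝔮)] -/
theorem tailReadout_mem_torsionFilAt_of_mem_twistedFil
    (t : ∀ k, (V.torsionGaloisModule ((p : ℤ) ^ (k + 1))).toContRepresentation →ⁱL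
      (V.torsionGaloisModule ((p : ℤ) ^ k)).toContRepresentation)
    (ht : ∀ k (P : geomTorsion V ((p : ℤ) ^ (k + 1))), t k P = V.geomTorsionReduce p k P) (j : ℕ)
    {y : Twisted p m j (geomTorsion V ((p : ℤ) ^ j))}
    (hy : y ∈ (V.ordinaryFiltrationAt v t ht).twistedFil j) :
    Twisted.tailReadout p hm j (V.geomTorsion_pow_nsmul_eq_zero p j) y ∈ V.torsionFilAt v ((p : ℤ) ^ j) := by
  induction hy using Submodule.span_induction with
  | mem x hx =>
    obtain ⟨c, a, ha, rfl⟩ := hx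
    rw [Twisted.tailReadout, CoeffExtension.readout_tmul]
    exact Submodule.smul_of_tower_mem _ _ ha
  | zero => rw [map_zero]; exact zero_mem _
  | add x y _ _ hx hy => rw [map_add]; exact add_mem hx hy
  | smul n x _ hx => rw [map_zsmul]; exact Submodule.smul_of_tower_mem _ _ hx

omit [NumberField K] in
/-- **Readouts along the reduction `T^{(j+1)} → T^{(j)}`**: in `E[p^∞]`,
`ι_j(λ_j(red y)) = p · ι_{j+1}(λ_{j+1}(y))` (`red = reduce ⊗ (P ↦ p·P)`, `λ_j ∘ red = (p·) ∘ λ_{j+1}`).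
[cite: Howard2004HeegnerKolyvagin, §1.6 (arXiv p. 12, L40–48) and §2.2] [cite: Washington1997, §13.2] -/
theorem inclusion_tailReadout_eisensteinTwistReduce (j : ℕ)
    (y : Twisted p m (j + 1) (geomTorsion V ((p : ℤ) ^ (j + 1)))) :
    AddSubgroup.inclusion (AcSigned.geomTorsion_zpow_le_geomPrimaryTorsion V p j)
        (Twisted.tailReadout p hm j (V.geomTorsion_pow_nsmul_eq_zero p j)
          ((κ.unitTwist (-1)).eisensteinTwistReduce hm (Nat.le_succ j) (V.torsionGaloisModuleReduce p j) y)) =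
      p • AddSubgroup.inclusion (AcSigned.geomTorsion_zpow_le_geomPrimaryTorsion V p (j + 1))
        (Twisted.tailReadout p hm (j + 1) (V.geomTorsion_pow_nsmul_eq_zero p (j + 1)) y) := by
  have h := Twisted.tailReadout_eisensteinTwistReduceLinear p hm (Nat.le_succ j)
    (V.geomTorsion_pow_nsmul_eq_zero p j) (V.geomTorsion_pow_nsmul_eq_zero p (j + 1))
    (V.torsionGaloisModuleReduce p j).toContinuousLinearMap.toLinearMap y
  apply Subtype.ext
  rw [AddSubgroup.coe_inclusion, AddSubgroupClass.coe_nsmul, AddSubgroup.coe_inclusion]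
  change ((Twisted.tailReadout p hm j (V.geomTorsion_pow_nsmul_eq_zero p j)
      (ZpExtension.eisensteinTwistReduceLinear (p := p) (Nat.le_succ j)
        (V.torsionGaloisModuleReduce p j).toContinuousLinearMap.toLinearMap y) :
      geomTorsion V ((p : ℤ) ^ j)) : geomPoints V) = _
  rw [h]
  change ((V.torsionGaloisModuleReduce p j _ : geomTorsion V ((p : ℤ) ^ j)) : geomPoints V) = _
  rw [coe_torsionGaloisModuleReduce, natCast_zsmul]

/-! ## §2 A class in the strict ordinary core: its readout on `Gal(K̄_v/K_{∞,w})` is a coboundary modulo `C_v` -/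

/-- For `σ ∈ Γ_{K_v}` restricting into `Gal(K̄/K_∞) = ker κ` the twisted local action on `T^{(j)}` is untwisted
(`χ = 1` on `ker κ`) and the tail readout is equivariant: `λ_j(σ · y) = res(σ) • λ_j(y)`.
[cite: GreenbergLNM1716, §4 p. 107] [cite: Howard2004HeegnerKolyvagin, §2.2] -/
theorem tailReadout_toLocal_apply_of_mem_kerSubgroup (j : ℕ) {σ : absoluteGaloisGroup (v.adicCompletion K)}
    (hσ : absGaloisRestrict K (v.adicCompletion K) σ ∈ κ.kerSubgroup)
    (y : Twisted p m j (geomTorsion V ((p : ℤ) ^ j))) :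
    Twisted.tailReadout p hm j (V.geomTorsion_pow_nsmul_eq_zero p j)
        (GaloisRep.toLocal v ((κ.unitTwist (-1)).eisensteinTwist (V.torsionGaloisModule ((p : ℤ) ^ j)) hm j) σ y) =
      absGaloisRestrict K (v.adicCompletion K) σ •
        Twisted.tailReadout p hm j (V.geomTorsion_pow_nsmul_eq_zero p j) y := by
  rw [GaloisRep.toLocal_apply, ZpExtension.eisensteinTwist_apply_eq_smul_mapEnd,
    κ.eisensteinTwistChar_unitTwist_eq_one_of_mem_kerSubgroup hm j (-1) hσ, one_smul, Twisted.tailReadout,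
    CoeffExtension.readout_mapEnd]
  rfl

/-- **A local class in the strict ordinary core reads out to a coboundary modulo `C_v` on `Gal(K̄_v/K_{∞,w})`.**
If `[η] ∈ ker(H¹(K_v, T^{(j)}) → H¹(K_v, T^{(j)}/(A ⊗ Fil_v)))` then there is `w ∈ E[p^∞]` with
`ι_j(λ_j(η(σ))) − (res σ • w − w) ∈ C_v = E[p^∞] ∩ E₁(K̄_v)` for every `σ ∈ Γ_{K_v}` restricting into `ker κ`
(`η(σ) − (σ·w₀ − w₀) ∈ A ⊗ Fil_v` for a `w₀ ∈ T^{(j)}`; read out with `λ_j`, equivariant there, `λ_j(A ⊗ Fil_v) ⊆ Fil_v`).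
[cite: Howard2004HeegnerKolyvagin, §3.1 (H¹_ord) and Def. 3.2.5] [cite: GreenbergLNM1716, §2 p. 73 (C_v)] -/
theorem exists_sub_mem_plus_of_mem_ordinaryCore
    (t : ∀ k, (V.torsionGaloisModule ((p : ℤ) ^ (k + 1))).toContRepresentation →ⁱL
      (V.torsionGaloisModule ((p : ℤ) ^ k)).toContRepresentation)
    (ht : ∀ k (P : geomTorsion V ((p : ℤ) ^ (k + 1))), t k P = V.geomTorsionReduce p k P) (j : ℕ)
    (η : contOneCocycles
      (((κ.unitTwist (-1)).eisensteinTwist (V.torsionGaloisModule ((p : ℤ) ^ j)) hm j).toLocal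
        (Sum.inr v : Place K)).toTopRep)
    (hη : oneCocycleClass _ η ∈ (V.ordinaryFiltrationAt v t ht).ordinaryCore (κ := κ.unitTwist (-1)) hm j) :
    ∃ w : V.geomPrimaryTorsion p, ∀ σ : absoluteGaloisGroup (v.adicCompletion K),
      absGaloisRestrict K (v.adicCompletion K) σ ∈ κ.kerSubgroup →
        AddSubgroup.inclusion (AcSigned.geomTorsion_zpow_le_geomPrimaryTorsion V p j)
            (Twisted.tailReadout p hm j (V.geomTorsion_pow_nsmul_eq_zero p j) (η.1 σ)) -
          (absGaloisRestrict K (v.adicCompletion K) σ • w - w) ∈ (V.kernelOfReductionLocalDatum p v).plus := by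
  -- unfold the core membership on the cocycle `η`
  have hq := (ZpExtension.OrdinaryFiltration.mem_ordinaryCore_iff (κ := κ.unitTwist (-1)) hm
    (V.ordinaryFiltrationAt v t ht) j (oneCocycleClass _ η)).1 hη
  change ContinuousCohomology.map (ContinuousMonoidHom.id _)
    (X := DiscreteGaloisModule.toTopRep (GaloisRep.toLocal v
      ((κ.unitTwist (-1)).eisensteinTwist (V.torsionGaloisModule ((p : ℤ) ^ j)) hm j)))
    (Y := DiscreteGaloisModule.toTopRep ((GaloisRep.toLocal v
      ((κ.unitTwist (-1)).eisensteinTwist (V.torsionGaloisModule ((p : ℤ) ^ j)) hm j)).quotient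
        ((V.ordinaryFiltrationAt v t ht).twistedFil j)
        ((V.ordinaryFiltrationAt v t ht).twistedFil_le_comap (κ := κ.unitTwist (-1)) hm j)))
    (TopRep.ofHom ⟨⟨((V.ordinaryFiltrationAt v t ht).twistedFil j).mkQ.toAddMonoidHom.toIntLinearMap,
      continuous_of_discreteTopology⟩, fun g ↦ ContinuousLinearMap.ext fun x ↦ rfl⟩) 1 (oneCocycleClass _ η) = 0 at hq
  rw [map_oneCocycleClass, oneCocycleClass_eq_zero_iff] at hq
  obtain ⟨wq, hwq⟩ := hq
  obtain ⟨w₀, rfl⟩ := Submodule.mkQ_surjective _ wq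
  refine ⟨AddSubgroup.inclusion (AcSigned.geomTorsion_zpow_le_geomPrimaryTorsion V p j)
    (Twisted.tailReadout p hm j (V.geomTorsion_pow_nsmul_eq_zero p j) w₀), fun σ hσ ↦ ?_⟩
  -- `η σ - (σ w₀ - w₀) ∈ A ⊗ Fil`
  have h1 : η.1 σ - (GaloisRep.toLocal v ((κ.unitTwist (-1)).eisensteinTwist (V.torsionGaloisModule ((p : ℤ) ^ j))
      hm j) σ w₀ - w₀) ∈ (V.ordinaryFiltrationAt v t ht).twistedFil j := by
    have h2 : ((V.ordinaryFiltrationAt v t ht).twistedFil j).mkQ (η.1 σ) =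
        ((V.ordinaryFiltrationAt v t ht).twistedFil j).mkQ
            (GaloisRep.toLocal v ((κ.unitTwist (-1)).eisensteinTwist (V.torsionGaloisModule ((p : ℤ) ^ j)) hm j) σ w₀) -
          ((V.ordinaryFiltrationAt v t ht).twistedFil j).mkQ w₀ := hwq σ
    rw [← map_sub] at h2
    exact (Submodule.Quotient.eq _).1 h2
  -- read out, equivariantly, into `Fil_v E[p^j]`
  have h3 := V.tailReadout_mem_torsionFilAt_of_mem_twistedFil hm v t ht j h1
  rw [map_sub, map_sub, V.tailReadout_toLocal_apply_of_mem_kerSubgroup κ hm v j hσ] at h3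
  -- and into `E[p^∞]`: `C_v` and `Fil_v E[p^j]` are cut out by the same condition on points
  rw [mem_kernelOfReductionLocalDatum_plus_iff]
  rw [mem_torsionFilAt_iff] at h3
  exact h3

/-- A class of the strict ordinary core, any representative form: `x ∈ core_J` gives a cocycle `η`, `[η] = x`, whose
readout is a coboundary modulo `C_v` on `{σ : res σ ∈ ker κ}`. [cite: Howard2004HeegnerKolyvagin, §3.1 (H¹_ord)] -/
theorem exists_cocycle_sub_mem_plus_of_mem_ordinaryCore
    (t : ∀ k, (V.torsionGaloisModule ((p : ℤ) ^ (k + 1))).toContRepresentation →ⁱL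
      (V.torsionGaloisModule ((p : ℤ) ^ k)).toContRepresentation)
    (ht : ∀ k (P : geomTorsion V ((p : ℤ) ^ (k + 1))), t k P = V.geomTorsionReduce p k P) (j : ℕ)
    (x : galoisCohomology (((κ.unitTwist (-1)).eisensteinTwist (V.torsionGaloisModule ((p : ℤ) ^ j)) hm j).toLocal
      (Sum.inr v : Place K)) 1)
    (hx : x ∈ (V.ordinaryFiltrationAt v t ht).ordinaryCore (κ := κ.unitTwist (-1)) hm j) :
    ∃ η : contOneCocycles
        (((κ.unitTwist (-1)).eisensteinTwist (V.torsionGaloisModule ((p : ℤ) ^ j)) hm j).toLocal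
          (Sum.inr v : Place K)).toTopRep,
      oneCocycleClass _ η = x ∧
      ∃ w : V.geomPrimaryTorsion p, ∀ σ : absoluteGaloisGroup (v.adicCompletion K),
        absGaloisRestrict K (v.adicCompletion K) σ ∈ κ.kerSubgroup →
          AddSubgroup.inclusion (AcSigned.geomTorsion_zpow_le_geomPrimaryTorsion V p j)
              (Twisted.tailReadout p hm j (V.geomTorsion_pow_nsmul_eq_zero p j) (η.1 σ)) -
            (absGaloisRestrict K (v.adicCompletion K) σ • w - w) ∈ (V.kernelOfReductionLocalDatum p v).plus := by
  obtain ⟨η, rfl⟩ := oneCocycleClass_surjective _ x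
  exact ⟨η, rfl, V.exists_sub_mem_plus_of_mem_ordinaryCore κ hm v t ht j η hx⟩

/-! ## §3 Descent along the compatible family: `ι ∘ λ_J ∘ red = p · ι ∘ λ_{J+1}` -/

set_option maxHeartbeats 400000 in
/-- **One step of descent.** If `p • x ∈ H¹(K_v, T^{(J+1)})` has a representative whose readout is a coboundary modulo
`C_v` on `{σ : res σ ∈ ker κ}`, then so does `red x ∈ H¹(K_v, T^{(J)})` — because `ι_J(λ_J(red y)) = p · ι_{J+1}(λ_{J+1}(y))`.
[cite: Howard2004HeegnerKolyvagin, §1.6 (arXiv p. 12) and Lemma 2.2.7 / Prop. 2.2.8] -/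
theorem exists_cocycle_sub_mem_plus_eisensteinLocalReduce (J : ℕ)
    (x : galoisCohomology (((κ.unitTwist (-1)).eisensteinTwist (V.torsionGaloisModule ((p : ℤ) ^ (J + 1))) hm
      (J + 1)).toLocal (Sum.inr v : Place K)) 1)
    (hx : ∃ η : contOneCocycles
        (((κ.unitTwist (-1)).eisensteinTwist (V.torsionGaloisModule ((p : ℤ) ^ (J + 1))) hm (J + 1)).toLocal
          (Sum.inr v : Place K)).toTopRep,
      oneCocycleClass _ η = p • x ∧
      ∃ w : V.geomPrimaryTorsion p, ∀ σ : absoluteGaloisGroup (v.adicCompletion K),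
        absGaloisRestrict K (v.adicCompletion K) σ ∈ κ.kerSubgroup →
          AddSubgroup.inclusion (AcSigned.geomTorsion_zpow_le_geomPrimaryTorsion V p (J + 1))
              (Twisted.tailReadout p hm (J + 1) (V.geomTorsion_pow_nsmul_eq_zero p (J + 1)) (η.1 σ)) -
            (absGaloisRestrict K (v.adicCompletion K) σ • w - w) ∈ (V.kernelOfReductionLocalDatum p v).plus) :
    ∃ η : contOneCocycles
        (((κ.unitTwist (-1)).eisensteinTwist (V.torsionGaloisModule ((p : ℤ) ^ J)) hm J).toLocal
          (Sum.inr v : Place K)).toTopRep,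
      oneCocycleClass _ η =
        (κ.unitTwist (-1)).eisensteinLocalReduce (fun i ↦ V.torsionGaloisModule ((p : ℤ) ^ i))
          (fun i ↦ V.torsionGaloisModuleReduce p i) hm (Sum.inr v) J x ∧
      ∃ w : V.geomPrimaryTorsion p, ∀ σ : absoluteGaloisGroup (v.adicCompletion K),
        absGaloisRestrict K (v.adicCompletion K) σ ∈ κ.kerSubgroup →
          AddSubgroup.inclusion (AcSigned.geomTorsion_zpow_le_geomPrimaryTorsion V p J)
              (Twisted.tailReadout p hm J (V.geomTorsion_pow_nsmul_eq_zero p J) (η.1 σ)) -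
            (absGaloisRestrict K (v.adicCompletion K) σ • w - w) ∈ (V.kernelOfReductionLocalDatum p v).plus := by
  obtain ⟨η, hη, w, hw⟩ := hx
  obtain ⟨η₀, rfl⟩ := oneCocycleClass_surjective _ x
  -- `η - p • η₀` is a coboundary `∂u`
  have hη' : oneCocycleClass _ (η - p • η₀) = 0 := by
    rw [oneCocycleClass_sub, ← oneCocycleClassₗ_apply _ (p • η₀), map_nsmul, oneCocycleClassₗ_apply, hη]
    exact sub_self _
  rw [oneCocycleClass_eq_zero_iff] at hη'
  obtain ⟨u, hu⟩ := hη'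
  -- the reduced cocycle `red ∘ η₀`
  refine ⟨contOneCocycles.pullback (ContinuousMonoidHom.id _)
      (TopRep.ofHom ⟨(Literature.NumberTheory.EllipticCurves.DiscreteGaloisModule.localMap ((κ.unitTwist (-1)).eisensteinTwistReduce hm (Nat.le_succ J)
        (V.torsionGaloisModuleReduce p J)) (Sum.inr v)).toContinuousLinearMap,
        (Literature.NumberTheory.EllipticCurves.DiscreteGaloisModule.localMap ((κ.unitTwist (-1)).eisensteinTwistReduce hm (Nat.le_succ J)
          (V.torsionGaloisModuleReduce p J)) (Sum.inr v)).isIntertwining'⟩) η₀, ?_,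
    w - AddSubgroup.inclusion (AcSigned.geomTorsion_zpow_le_geomPrimaryTorsion V p (J + 1))
      (Twisted.tailReadout p hm (J + 1) (V.geomTorsion_pow_nsmul_eq_zero p (J + 1)) u), fun σ hσ ↦ ?_⟩
  · -- `red [η₀] = [red ∘ η₀]`
    change _ = ContinuousCohomology.map _ _ 1 (oneCocycleClass _ η₀)
    rw [map_oneCocycleClass]
  · -- the readout of `red (η₀ σ)` is `p •` that of `η₀ σ`, and `p • η₀ σ = η σ - (σ u - u)`
    have hval : (contOneCocycles.pullback (ContinuousMonoidHom.id _)
        (TopRep.ofHom ⟨(Literature.NumberTheory.EllipticCurves.DiscreteGaloisModule.localMap ((κ.unitTwist (-1)).eisensteinTwistReduce hm (Nat.le_succ J)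
          (V.torsionGaloisModuleReduce p J)) (Sum.inr v)).toContinuousLinearMap,
          (Literature.NumberTheory.EllipticCurves.DiscreteGaloisModule.localMap ((κ.unitTwist (-1)).eisensteinTwistReduce hm (Nat.le_succ J)
            (V.torsionGaloisModuleReduce p J)) (Sum.inr v)).isIntertwining'⟩) η₀).1 σ =
        (κ.unitTwist (-1)).eisensteinTwistReduce hm (Nat.le_succ J) (V.torsionGaloisModuleReduce p J) (η₀.1 σ) := rfl
    have hu' : p • η₀.1 σ = η.1 σ -
        (GaloisRep.toLocal v ((κ.unitTwist (-1)).eisensteinTwist (V.torsionGaloisModule ((p : ℤ) ^ (J + 1))) hm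
          (J + 1)) σ u - u) := by
      have h := hu σ
      change η.1 σ - p • η₀.1 σ = GaloisRep.toLocal v ((κ.unitTwist (-1)).eisensteinTwist
        (V.torsionGaloisModule ((p : ℤ) ^ (J + 1))) hm (J + 1)) σ u - u at h
      rw [← h, sub_sub_cancel]
    have h1 : AddSubgroup.inclusion (AcSigned.geomTorsion_zpow_le_geomPrimaryTorsion V p (J + 1))
        (Twisted.tailReadout p hm (J + 1) (V.geomTorsion_pow_nsmul_eq_zero p (J + 1)) (p • η₀.1 σ)) =
        p • AddSubgroup.inclusion (AcSigned.geomTorsion_zpow_le_geomPrimaryTorsion V p (J + 1))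
          (Twisted.tailReadout p hm (J + 1) (V.geomTorsion_pow_nsmul_eq_zero p (J + 1)) (η₀.1 σ)) := by
      rw [map_nsmul, map_nsmul]
    rw [hval, V.inclusion_tailReadout_eisensteinTwistReduce κ hm J, ← h1, hu']
    rw [map_sub, map_sub, map_sub, map_sub, V.tailReadout_toLocal_apply_of_mem_kerSubgroup κ hm v (J + 1) hσ]
    -- bookkeeping in the abelian group `E[p^∞]`
    have key : ∀ (a b c : V.geomPrimaryTorsion p) (g : absoluteGaloisGroup K),
        a - (g • b - b) - (g • (c - b) - (c - b)) = a - (g • c - c) := by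
      intro a b c g; rw [smul_sub]; abel
    rw [show ∀ (b : geomTorsion V ((p : ℤ) ^ (J + 1))) (g : absoluteGaloisGroup K),
        AddSubgroup.inclusion (AcSigned.geomTorsion_zpow_le_geomPrimaryTorsion V p (J + 1)) (g • b) =
          g • AddSubgroup.inclusion (AcSigned.geomTorsion_zpow_le_geomPrimaryTorsion V p (J + 1)) b from
        fun _ _ ↦ rfl, key]
    exact hw σ hσ

set_option maxHeartbeats 400000 in
/-- **Descent along a compatible family of local classes.** For a compatible family `(x_i)_i` of the local tower at `v`
(`red_i x_{i+1} = x_i`) and `d ≥ 0`: if `p^d • x_{j+d}` has a representative whose readout is a coboundary modulo `C_v` on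
`{σ : res σ ∈ ker κ}`, then so does `x_j` (induction on `d` with `exists_cocycle_sub_mem_plus_eisensteinLocalReduce`).
[cite: Howard2004HeegnerKolyvagin, Def. 2.1.1 (propagation) and Lemma 2.2.7 / Prop. 2.2.8] -/
theorem exists_cocycle_sub_mem_plus_of_compatible (d : ℕ) :
    ∀ (j : ℕ)
      (x : ∀ i, galoisCohomology (((κ.unitTwist (-1)).eisensteinTwist (V.torsionGaloisModule ((p : ℤ) ^ i)) hm i).toLocal
        (Sum.inr v : Place K)) 1),
      (∀ i, (κ.unitTwist (-1)).eisensteinLocalReduce (fun i ↦ V.torsionGaloisModule ((p : ℤ) ^ i))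
          (fun i ↦ V.torsionGaloisModuleReduce p i) hm (Sum.inr v) i (x (i + 1)) = x i) →
      (∃ η : contOneCocycles
          (((κ.unitTwist (-1)).eisensteinTwist (V.torsionGaloisModule ((p : ℤ) ^ (j + d))) hm (j + d)).toLocal
            (Sum.inr v : Place K)).toTopRep,
        oneCocycleClass _ η = p ^ d • x (j + d) ∧
        ∃ w : V.geomPrimaryTorsion p, ∀ σ : absoluteGaloisGroup (v.adicCompletion K),
          absGaloisRestrict K (v.adicCompletion K) σ ∈ κ.kerSubgroup →
            AddSubgroup.inclusion (AcSigned.geomTorsion_zpow_le_geomPrimaryTorsion V p (j + d))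
                (Twisted.tailReadout p hm (j + d) (V.geomTorsion_pow_nsmul_eq_zero p (j + d)) (η.1 σ)) -
              (absGaloisRestrict K (v.adicCompletion K) σ • w - w) ∈ (V.kernelOfReductionLocalDatum p v).plus) →
      ∃ η : contOneCocycles
          (((κ.unitTwist (-1)).eisensteinTwist (V.torsionGaloisModule ((p : ℤ) ^ j)) hm j).toLocal
            (Sum.inr v : Place K)).toTopRep,
        oneCocycleClass _ η = x j ∧
        ∃ w : V.geomPrimaryTorsion p, ∀ σ : absoluteGaloisGroup (v.adicCompletion K),
          absGaloisRestrict K (v.adicCompletion K) σ ∈ κ.kerSubgroup →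
            AddSubgroup.inclusion (AcSigned.geomTorsion_zpow_le_geomPrimaryTorsion V p j)
                (Twisted.tailReadout p hm j (V.geomTorsion_pow_nsmul_eq_zero p j) (η.1 σ)) -
              (absGaloisRestrict K (v.adicCompletion K) σ • w - w) ∈ (V.kernelOfReductionLocalDatum p v).plus := by
  induction d with
  | zero =>
    intro j x _ h
    rw [pow_zero, one_smul] at h
    exact h
  | succ d ih =>
    intro j x hx h
    rw [pow_succ', mul_smul] at h
    have h1 := V.exists_cocycle_sub_mem_plus_eisensteinLocalReduce κ hm v (j + d) (p ^ d • x (j + d + 1)) h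
    have h2 : (κ.unitTwist (-1)).eisensteinLocalReduce (fun i ↦ V.torsionGaloisModule ((p : ℤ) ^ i))
        (fun i ↦ V.torsionGaloisModuleReduce p i) hm (Sum.inr v) (j + d) (p ^ d • x (j + d + 1)) =
        p ^ d • x (j + d) := by
      rw [map_nsmul, hx (j + d)]
    rw [h2] at h1
    exact ih j x hx h1

end WeierstrassCurve
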